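import Summits.QuantumFields.BalabanUV.Beta.ResolventResidualLeafRecord
import Mathlib.Data.Nat.Choose.Multinomial

/-!
# Beta / ResolventTaylorCoefficients — THE SUP STEP IN THE KERNEL: the order-m Taylor family IS a matrix polynomial in the box displacement with
# EXPLICIT coefficients, products of polynomial families have CONVOLVED coefficients, hence the residual `1 − P(q)·taylorFamily(q)` of a polynomial
# preconditioner is an explicit polynomial family and the order-m leaf follows from two FINITE coefficient-norm sums
# (β sub-cell, BINDER-OWNERS row CAP-k, lineage `b2b-balaban-beta-an5`, gen 27; node BETA-an5-g27-COEFF, leaf 1; cap4-g18's (R′) of journal l.18925)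

WHY.  Engine D (cap4-g18 «DLEAF» l.18925, cap-ref #90 R90-a-1 ∕ WATCH I-capref90-1) certifies its hG-free leaves through
`ResolventBoxCertificateTaylor.box_certificate_of_residual`; what rests on paper + program is «the SUP STEP» — that the engine's `θ`, `p` dominate
`sup_box ‖1 − P(q)·A(q)‖` and `sup_box ‖P(q)‖` (README §2 (P): order-N Taylor family, closed-form tail, snapped coefficient matrices, SUB-BOX TILING +
MVT, exact Schatten∕Frobenius bounds).  This module removes the tiling∕MVT step: for a POLYNOMIAL preconditioner `P(q) = Σ_{β∈T_P} δ(q)^β Z_β`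
(`δ = boxDisp c q`) the whole residual against the order-m Taylor family is ITSELF an explicit polynomial in `δ`, so gen 23's `norm_polyEval_boxDisp_le`
(`‖Σ_γ δ^γ C_γ‖ ≤ Σ_γ h^γ ‖C_γ‖` on the box) bounds both sups by FINITE SUMS OF NORMS OF EXPLICITLY DEFINED MATRICES — no sup, no sub-box, no
mean-value theorem; every engine number of a residual leaf becomes the norm of ONE explicit matrix (for which the exact Frobenius ∕ Schatten sockets
`ResolventBoxCertificateNorms.l2_opNorm_le_frobenius`, `ResolventBlockCertificate.l2_opNorm_le_of_schatten8` apply).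

* §1 `degLT d m` — the multi-indices `κ : Fin (d+1) → ℕ` of total degree `< m` (`mem_degLT`).
* §2 THE MULTINOMIAL STEP: `(Σ_μ a_μ)^k ∕ k! = Σ_{|κ| = k} Π_μ a_μ^{κ_μ} ∕ κ_μ!` (`sum_pow_div_factorial`, Mathlib's `Finset.sum_pow_eq_sum_piAntidiag`),
  hence `charTaylor m x c q = Σ_{κ ∈ degLT d m} δ^κ · χ_c(x) · charWeight x κ`, `charWeight x κ = Π_μ (i x_μ)^{κ_μ} ∕ κ_μ!` (`charTaylor_eq_sum_degLT`), and
  **`taylorFamily_eq_polyEval`**: `taylorFamily m S K c q = polyEval (degLT d m) (taylorCoeff S K c) (boxDisp c q)` with the EXPLICIT coefficients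
  `taylorCoeff S K c κ = Σ_{x∈S} χ_c(x)·charWeight x κ · K[x]`.
* §3 PRODUCTS: `monomial (β + κ) = monomial β · monomial κ`; **`polyEval_mul_polyEval`**: `polyEval T₁ C₁ δ · polyEval T₂ C₂ δ = polyEval (T₁ + T₂)
  (convCoeff T₁ T₂ C₁ C₂) δ`, `convCoeff γ = Σ_{β∈T₁, κ∈T₂, β+κ=γ} C₁ β · C₂ κ` (the Cauchy product; `T₁ + T₂` the pointwise-sum Finset).
* §4 THE RESIDUAL POLYNOMIAL: **`one_sub_polyEval_mul_taylorFamily`**: `1 − polyEval T_P Z δ · taylorFamily m S K c q = polyEval (insert 0 (T_P + degLT d m))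
  (residualCoeff T_P Z m S K c) δ`, `residualCoeff γ = [γ = 0]·1 − convCoeff T_P (degLT d m) Z (taylorCoeff S K c) γ`.
* §5 **`box_certificate_taylor_ofCoeffs`** — THE ORDER-m LEAF IN COEFFICIENT CURRENCY: engine data = the coefficient matrices `Z_β` (any) and two numbers
  `ε ≥ Σ_{γ} h^γ ‖residualCoeff γ‖`, `p ≥ Σ_{β} h^β ‖Z_β‖`; kernel = the tail `taylorTail`; checks `ε + p·taylorTail ≤ θ < 1`, `p∕(1−θ) ≤ B` ⟹ on the whole
  box `IsUnit (A q).det ∧ ‖(A q)⁻¹‖ ≤ B` for the stencil family `A q = Σ_{x∈S} χ_q(x) K[x]` — the per-leaf conclusion every route-A anchor consumes.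
* §6 THE ADMITTED RESIDUAL RECORD (p230938) IN COEFFICIENT CURRENCY: `ResidualLeafRecord.certifies_ofCoeffs` (the record's `θ`, `p` now MEAN
  `θ ≥ ε + p·T`, `p ≥ Σ h^β‖Z_β‖` — no new record format) and `hcert_of_residualRecords_ofCoeffs` = the binder `hcert` of
  `ResolventLeafRecord.rowsOfOneLoopFormCode16E_routeA₂_ofSchedulesQ` for the stencil family `A q = Σ_{x∈S} χ_q(x) K[x]`, whose per-leaf engine
  deliverable is now (Z_β)_β + two finite coefficient-norm sums + a tail number.

WHAT STAYS OUTSIDE THE KERNEL (honest division of labour): the matrices `Z_β` are the engine's (its snapped Taylor coefficients of `A(c)⁻¹`; never in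
the tree); the two numbers `ε`, `p` are sums of Euclidean operator norms of EXPLICIT matrices (`residualCoeff γ` involves `χ_c(x)`, i.e. `exp` of
rationals — enclosed by the engine's interval arithmetic), certified by two implementations (R81-d) ∕ re-checked exactly (R88-a); the kernel
supplies the identity that makes them sufficient.  The coefficient-norm `p` is cruder than engine D's tiling `p` (cap4 l.18925: ≈ 597 vs 411.9 on
the worst-corner box, `B ≈ 601 ≤ 780` — the budgeted predicate survives; cap4's float information, not asserted here).

HONEST FRAMING.  Kernel glue ([folklore] multinomial bookkeeping); no coefficient, no box, no number supplied; 0 binders of the real row instantiated;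
0 certified coefficients; discharging `BetaPertH` would make Bałaban's ultraviolet stability UNCONDITIONAL — NOT the continuum limit, NOT the Clay
problem.  HONEST DEPENDENCY: continuum YM on T⁴ ⇐ BetaPertH ∧ nine spine estimates (0∕9 proved); BetaPertH ⇐ (D1) ∧ (D4) ∧ CAP+tail; G-an2-4
gates asym, D1 and NE2∕3∕4.  0 `sorry`, 0 cite tags.
-/

namespace Summit.QuantumFields.BalabanUV.Beta.ResolventBoxCertificate

open Complex Set Matrix Finset
open Summit.QuantumFields.BalabanUV.Beta.PolyRegularAlgebra (character)
open scoped Real Matrix.Norms.L2Operator Pointwise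

noncomputable section

variable {d : ℕ} {n : Type*} [Fintype n] [DecidableEq n]

/-! ## §1 Multi-indices of total degree `< m` -/

/-- the multi-indices `κ : Fin (d+1) → ℕ` of total degree `Σ_μ κ_μ < m`. [folklore] -/
def degLT (d m : ℕ) : Finset (Fin (d + 1) → ℕ) := (range m).biUnion fun k => (univ : Finset (Fin (d + 1))).piAntidiag k

/-- membership: `κ ∈ degLT d m ↔ Σ_μ κ_μ < m`. [folklore] -/
theorem mem_degLT {m : ℕ} {κ : Fin (d + 1) → ℕ} : κ ∈ degLT d m ↔ ∑ μ, κ μ < m := by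
  constructor
  · intro h
    obtain ⟨k, hk, hκ⟩ := Finset.mem_biUnion.mp h
    rw [Finset.mem_piAntidiag] at hκ
    rw [hκ.1]
    exact Finset.mem_range.mp hk
  · intro h
    exact Finset.mem_biUnion.mpr ⟨_, Finset.mem_range.mpr h, Finset.mem_piAntidiag.mpr ⟨rfl, fun _ _ => Finset.mem_univ _⟩⟩

/-- the zero multi-index has degree `< m` for `0 < m`. [folklore] -/
theorem zero_mem_degLT {m : ℕ} (hm : 0 < m) : (0 : Fin (d + 1) → ℕ) ∈ degLT d m := by
  rw [mem_degLT]; simpa using hm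

/-- the degree layers are pairwise disjoint. [folklore] -/
theorem pairwiseDisjoint_piAntidiag (s : Set ℕ) :
    s.PairwiseDisjoint fun k => (univ : Finset (Fin (d + 1))).piAntidiag k := by
  intro k _ l _ hkl
  rw [Function.onFun, Finset.disjoint_left]
  intro κ hk hl
  rw [mem_piAntidiag] at hk hl
  exact hkl (hk.1.symm.trans hl.1)

/-! ## §2 The Taylor family is a polynomial family in the box displacement -/

/-- **THE MULTINOMIAL STEP**: `(Σ_μ a_μ)^k ∕ k! = Σ_{|κ| = k} Π_μ a_μ^{κ_μ} ∕ κ_μ!`. [folklore] -/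
theorem sum_pow_div_factorial (a : Fin (d + 1) → ℂ) (k : ℕ) :
    (∑ μ, a μ) ^ k / (k.factorial : ℂ) = ∑ κ ∈ (univ : Finset (Fin (d + 1))).piAntidiag k, ∏ μ, a μ ^ κ μ / ((κ μ).factorial : ℂ) := by
  rw [Finset.sum_pow_eq_sum_piAntidiag, Finset.sum_div]
  refine Finset.sum_congr rfl fun κ hκ => ?_
  rw [mem_piAntidiag] at hκ
  have hspec : ((∏ μ, (κ μ).factorial : ℕ) : ℂ) * (Nat.multinomial univ κ : ℂ) = (k.factorial : ℂ) := by
    rw [← hκ.1]; exact_mod_cast Nat.multinomial_spec univ κ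
  have hk : (k.factorial : ℂ) ≠ 0 := by exact_mod_cast k.factorial_ne_zero
  have hP : ((∏ μ, (κ μ).factorial : ℕ) : ℂ) ≠ 0 := by
    rw [Nat.cast_prod]; exact Finset.prod_ne_zero_iff.mpr fun μ _ => by exact_mod_cast (κ μ).factorial_ne_zero
  rw [Finset.prod_div_distrib, div_eq_div_iff hk (by rw [← Nat.cast_prod]; exact hP), ← hspec, Nat.cast_prod]
  ring

/-- the MULTI-INDEX WEIGHT of the character `x`: `Π_μ (i x_μ)^{κ_μ} ∕ κ_μ!`. [folklore] -/
def charWeight (x : Fin (d + 1) → ℤ) (κ : Fin (d + 1) → ℕ) : ℂ := ∏ μ, (I * (x μ : ℂ)) ^ κ μ / ((κ μ).factorial : ℂ)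

/-- the real monomial cast to `ℂ` is the product of the cast powers. [folklore] -/
theorem ofReal_monomial (κ : Fin (d + 1) → ℕ) (δ : Fin (d + 1) → ℝ) :
    ((monomial κ δ : ℝ) : ℂ) = ∏ μ, ((δ μ : ℝ) : ℂ) ^ κ μ := by
  simp [monomial, Complex.ofReal_prod, Complex.ofReal_pow]

/-- one Taylor term of one character: `(i·phaseIncr)^k ∕ k! = Σ_{|κ|=k} δ^κ · charWeight x κ`. [folklore] -/
theorem pow_phaseIncr_div_factorial (x : Fin (d + 1) → ℤ) (c q : Fin (d + 1) → ℂ) (k : ℕ) :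
    (I * (phaseIncr x c q : ℂ)) ^ k / (k.factorial : ℂ)
      = ∑ κ ∈ (univ : Finset (Fin (d + 1))).piAntidiag k, ((monomial κ (boxDisp c q) : ℝ) : ℂ) * charWeight x κ := by
  have e : I * (phaseIncr x c q : ℂ) = ∑ μ, ((boxDisp c q μ : ℝ) : ℂ) * (I * (x μ : ℂ)) := by
    simp only [phaseIncr, boxDisp]
    push_cast
    rw [Finset.mul_sum]
    exact Finset.sum_congr rfl fun μ _ => by ring
  rw [e, sum_pow_div_factorial]
  refine Finset.sum_congr rfl fun κ _ => ?_
  rw [ofReal_monomial, charWeight, ← Finset.prod_mul_distrib]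
  exact Finset.prod_congr rfl fun μ _ => by rw [mul_pow]; ring

/-- **ONE CHARACTER'S TAYLOR POLYNOMIAL IN MULTI-INDEX FORM**: `charTaylor m x c q = Σ_{κ ∈ degLT d m} δ^κ · (χ_c(x) · charWeight x κ)`. [folklore] -/
theorem charTaylor_eq_sum_degLT (m : ℕ) (x : Fin (d + 1) → ℤ) (c q : Fin (d + 1) → ℂ) :
    charTaylor m x c q = ∑ κ ∈ degLT d m, ((monomial κ (boxDisp c q) : ℝ) : ℂ) * (character x c * charWeight x κ) := by
  rw [charTaylor, degLT, Finset.sum_biUnion (pairwiseDisjoint_piAntidiag _), Finset.mul_sum]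
  refine Finset.sum_congr rfl fun k _ => ?_
  rw [pow_phaseIncr_div_factorial, Finset.mul_sum]
  exact Finset.sum_congr rfl fun κ _ => by ring

/-- **THE TAYLOR COEFFICIENT** of multi-index `κ`: `Σ_{x∈S} χ_c(x) · charWeight x κ · K[x]` — an EXPLICIT matrix from the tables. [folklore] -/
def taylorCoeff (S : Finset (Fin (d + 1) → ℤ)) (K : (Fin (d + 1) → ℤ) → Matrix n n ℂ) (c : Fin (d + 1) → ℂ)
    (κ : Fin (d + 1) → ℕ) : Matrix n n ℂ :=
  ∑ x ∈ S, (character x c * charWeight x κ) • K x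

omit [Fintype n] [DecidableEq n] in
/-- **THE TAYLOR FAMILY IS A POLYNOMIAL FAMILY IN THE BOX DISPLACEMENT**:
`taylorFamily m S K c q = polyEval (degLT d m) (taylorCoeff S K c) (boxDisp c q)`. [folklore] -/
theorem taylorFamily_eq_polyEval (m : ℕ) (S : Finset (Fin (d + 1) → ℤ)) (K : (Fin (d + 1) → ℤ) → Matrix n n ℂ)
    (c q : Fin (d + 1) → ℂ) : taylorFamily m S K c q = polyEval (degLT d m) (taylorCoeff S K c) (boxDisp c q) := by
  simp only [taylorFamily, charTaylor_eq_sum_degLT, Finset.sum_smul, polyEval, taylorCoeff, Finset.smul_sum, smul_smul]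
  rw [Finset.sum_comm]

/-! ## §3 Products of polynomial families: convolved coefficients -/

/-- monomials multiply by adding multi-indices. [folklore] -/
theorem monomial_add (β κ : Fin (d + 1) → ℕ) (δ : Fin (d + 1) → ℝ) : monomial (β + κ) δ = monomial β δ * monomial κ δ := by
  rw [monomial, monomial, monomial, ← Finset.prod_mul_distrib]
  exact Finset.prod_congr rfl fun μ _ => by rw [Pi.add_apply, pow_add]

/-- monomials are nonnegative on nonnegative arguments. [folklore] -/
theorem monomial_nonneg (β : Fin (d + 1) → ℕ) {h : Fin (d + 1) → ℝ} (hh : ∀ μ, 0 ≤ h μ) : 0 ≤ monomial β h :=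
  Finset.prod_nonneg fun μ _ => pow_nonneg (hh μ) _

/-- the monomial of the zero multi-index is `1`. [folklore] -/
@[simp] theorem monomial_zero (δ : Fin (d + 1) → ℝ) : monomial 0 δ = 1 := by
  simp [monomial]

variable [DecidableEq (Fin (d + 1) → ℕ)]

/-- **THE CONVOLVED (CAUCHY-PRODUCT) COEFFICIENTS**: `convCoeff γ = Σ_{β∈T₁} Σ_{κ∈T₂} [β + κ = γ] · C₁ β · C₂ κ`. [folklore] -/
def convCoeff (T₁ T₂ : Finset (Fin (d + 1) → ℕ)) (C₁ C₂ : (Fin (d + 1) → ℕ) → Matrix n n ℂ) (γ : Fin (d + 1) → ℕ) :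
    Matrix n n ℂ :=
  ∑ β ∈ T₁, ∑ κ ∈ T₂, if β + κ = γ then C₁ β * C₂ κ else 0

omit [DecidableEq n] in
/-- the convolved coefficient vanishes off the sumset `T₁ + T₂`. [folklore] -/
theorem convCoeff_eq_zero_of_not_mem {T₁ T₂ : Finset (Fin (d + 1) → ℕ)} (C₁ C₂ : (Fin (d + 1) → ℕ) → Matrix n n ℂ)
    {γ : Fin (d + 1) → ℕ} (hγ : γ ∉ T₁ + T₂) : convCoeff T₁ T₂ C₁ C₂ γ = 0 := by
  refine Finset.sum_eq_zero fun β hβ => Finset.sum_eq_zero fun κ hκ => ?_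
  rw [if_neg]
  rintro rfl
  exact hγ (Finset.add_mem_add hβ hκ)

omit [DecidableEq n] in
/-- **THE PRODUCT OF TWO POLYNOMIAL FAMILIES IS THE POLYNOMIAL FAMILY OF THE CONVOLVED COEFFICIENTS** on the sumset. [folklore] -/
theorem polyEval_mul_polyEval (T₁ T₂ : Finset (Fin (d + 1) → ℕ)) (C₁ C₂ : (Fin (d + 1) → ℕ) → Matrix n n ℂ)
    (δ : Fin (d + 1) → ℝ) :
    polyEval T₁ C₁ δ * polyEval T₂ C₂ δ = polyEval (T₁ + T₂) (convCoeff T₁ T₂ C₁ C₂) δ := by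
  -- left side: the double sum of `δ^{β+κ} • (C₁ β · C₂ κ)`
  have hL : polyEval T₁ C₁ δ * polyEval T₂ C₂ δ
      = ∑ β ∈ T₁, ∑ κ ∈ T₂, ((monomial (β + κ) δ : ℝ) : ℂ) • (C₁ β * C₂ κ) := by
    rw [polyEval, polyEval, Finset.sum_mul]
    refine Finset.sum_congr rfl fun β _ => ?_
    rw [Finset.mul_sum]
    refine Finset.sum_congr rfl fun κ _ => ?_
    rw [Matrix.smul_mul, Matrix.mul_smul, smul_smul, monomial_add, Complex.ofReal_mul]
  -- right side: regroup by `γ = β + κ`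
  have hR : polyEval (T₁ + T₂) (convCoeff T₁ T₂ C₁ C₂) δ
      = ∑ β ∈ T₁, ∑ κ ∈ T₂, ((monomial (β + κ) δ : ℝ) : ℂ) • (C₁ β * C₂ κ) := by
    rw [polyEval]
    have e1 : ∑ γ ∈ T₁ + T₂, ((monomial γ δ : ℝ) : ℂ) • convCoeff T₁ T₂ C₁ C₂ γ
        = ∑ γ ∈ T₁ + T₂, ∑ β ∈ T₁, ∑ κ ∈ T₂, (if β + κ = γ then ((monomial γ δ : ℝ) : ℂ) • (C₁ β * C₂ κ) else 0) := by
      refine Finset.sum_congr rfl fun γ _ => ?_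
      rw [convCoeff, Finset.smul_sum]
      refine Finset.sum_congr rfl fun β _ => ?_
      rw [Finset.smul_sum]
      refine Finset.sum_congr rfl fun κ _ => ?_
      split_ifs <;> simp
    rw [e1, Finset.sum_comm]
    refine Finset.sum_congr rfl fun β hβ => ?_
    rw [Finset.sum_comm]
    refine Finset.sum_congr rfl fun κ hκ => ?_
    rw [Finset.sum_ite_eq (T₁ + T₂) (β + κ) (fun γ => ((monomial γ δ : ℝ) : ℂ) • (C₁ β * C₂ κ)), if_pos (Finset.add_mem_add hβ hκ)]
  rw [hL, hR]

/-! ## §4 The residual polynomial of a polynomial preconditioner against the Taylor family -/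

/-- **THE RESIDUAL COEFFICIENTS**: `residualCoeff γ = [γ = 0]·1 − Σ_{β+κ=γ} Z_β · taylorCoeff κ` — EXPLICIT matrices from `Z`, the tables and the
centre. [folklore] -/
def residualCoeff (T_P : Finset (Fin (d + 1) → ℕ)) (Z : (Fin (d + 1) → ℕ) → Matrix n n ℂ) (m : ℕ) (S : Finset (Fin (d + 1) → ℤ))
    (K : (Fin (d + 1) → ℤ) → Matrix n n ℂ) (c : Fin (d + 1) → ℂ) (γ : Fin (d + 1) → ℕ) : Matrix n n ℂ :=
  (if γ = 0 then 1 else 0) - convCoeff T_P (degLT d m) Z (taylorCoeff S K c) γ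

/-- **THE RESIDUAL OF A POLYNOMIAL PRECONDITIONER AGAINST THE TAYLOR FAMILY IS AN EXPLICIT POLYNOMIAL FAMILY**:
`1 − polyEval T_P Z δ · taylorFamily m S K c q = polyEval (insert 0 (T_P + degLT d m)) (residualCoeff T_P Z m S K c) δ`, `δ = boxDisp c q`. [folklore] -/
theorem one_sub_polyEval_mul_taylorFamily (T_P : Finset (Fin (d + 1) → ℕ)) (Z : (Fin (d + 1) → ℕ) → Matrix n n ℂ) (m : ℕ)
    (S : Finset (Fin (d + 1) → ℤ)) (K : (Fin (d + 1) → ℤ) → Matrix n n ℂ) (c q : Fin (d + 1) → ℂ) :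
    1 - polyEval T_P Z (boxDisp c q) * taylorFamily m S K c q
      = polyEval (insert 0 (T_P + degLT d m)) (residualCoeff T_P Z m S K c) (boxDisp c q) := by
  rw [taylorFamily_eq_polyEval, polyEval_mul_polyEval]
  set δ := boxDisp c q
  set Γ := T_P + degLT d m
  have h1 : ∑ γ ∈ insert 0 Γ, ((monomial γ δ : ℝ) : ℂ) • (if γ = 0 then (1 : Matrix n n ℂ) else 0) = 1 := by
    have e : ∀ γ ∈ insert 0 Γ, ((monomial γ δ : ℝ) : ℂ) • (if γ = 0 then (1 : Matrix n n ℂ) else 0)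
        = if γ = 0 then ((monomial γ δ : ℝ) : ℂ) • (1 : Matrix n n ℂ) else 0 := fun γ _ => by
      split_ifs <;> simp
    rw [Finset.sum_congr rfl e, Finset.sum_ite_eq' (insert 0 Γ) 0, if_pos (Finset.mem_insert_self _ _), monomial_zero]
    simp
  have h2 : ∑ γ ∈ insert 0 Γ, ((monomial γ δ : ℝ) : ℂ) • convCoeff T_P (degLT d m) Z (taylorCoeff S K c) γ
      = polyEval Γ (convCoeff T_P (degLT d m) Z (taylorCoeff S K c)) δ := by
    rw [polyEval]
    refine Finset.sum_insert_of_eq_zero_if_notMem fun h0 => ?_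
    rw [convCoeff_eq_zero_of_not_mem _ _ h0, smul_zero]
  symm
  calc polyEval (insert 0 Γ) (residualCoeff T_P Z m S K c) δ
      = ∑ γ ∈ insert 0 Γ, (((monomial γ δ : ℝ) : ℂ) • (if γ = 0 then (1 : Matrix n n ℂ) else 0)
          - ((monomial γ δ : ℝ) : ℂ) • convCoeff T_P (degLT d m) Z (taylorCoeff S K c) γ) :=
        Finset.sum_congr rfl fun γ _ => by rw [residualCoeff, smul_sub]
    _ = 1 - polyEval Γ (convCoeff T_P (degLT d m) Z (taylorCoeff S K c)) δ := by rw [Finset.sum_sub_distrib, h1, h2]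

/-! ## §5 The order-m leaf in COEFFICIENT CURRENCY -/

omit [DecidableEq (Fin (d + 1) → ℕ)] in
/-- a coefficient-norm sum is nonnegative on a box with nonnegative half-widths. [folklore] -/
theorem coeffNormSum_nonneg (T : Finset (Fin (d + 1) → ℕ)) (C : (Fin (d + 1) → ℕ) → Matrix n n ℂ) {h : Fin (d + 1) → ℝ}
    (hh : ∀ μ, 0 ≤ h μ) : 0 ≤ ∑ β ∈ T, monomial β h * ‖C β‖ :=
  Finset.sum_nonneg fun β _ => mul_nonneg (monomial_nonneg β hh) (norm_nonneg _)

/-- **THE ORDER-m BOX CERTIFICATE IN COEFFICIENT CURRENCY** (one leaf; the SUP STEP is the kernel's).  ENGINE DATA: the coefficient matrices `Z_β`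
(`β ∈ T_P`) of a polynomial preconditioner and two numbers — `ε ≥ Σ_{γ ∈ insert 0 (T_P + degLT d m)} h^γ ‖residualCoeff γ‖` and
`p ≥ Σ_{β ∈ T_P} h^β ‖Z_β‖` (finite sums of norms of EXPLICIT matrices); KERNEL: the tail `taylorTail m S K c h`; CHECKS: `ε + p·taylorTail ≤ θ < 1`,
`p∕(1−θ) ≤ B`.  THEN on the whole box `A q = Σ_{x∈S} χ_q(x) K[x]` is invertible with `‖(A q)⁻¹‖ ≤ B`. [folklore] -/
theorem box_certificate_taylor_ofCoeffs {m : ℕ} (hm : 0 < m) (S : Finset (Fin (d + 1) → ℤ)) (K : (Fin (d + 1) → ℤ) → Matrix n n ℂ)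
    {c : Fin (d + 1) → ℂ} {h : Fin (d + 1) → ℝ} (hsmall : ∀ x ∈ S, ∑ μ, |(x μ : ℝ)| * h μ ≤ 1)
    (T_P : Finset (Fin (d + 1) → ℕ)) (Z : (Fin (d + 1) → ℕ) → Matrix n n ℂ) {ε p θ B : ℝ}
    (hE : ∑ γ ∈ insert 0 (T_P + degLT d m), monomial γ h * ‖residualCoeff T_P Z m S K c γ‖ ≤ ε)
    (hP : ∑ β ∈ T_P, monomial β h * ‖Z β‖ ≤ p)
    (hθ : ε + p * taylorTail m S K c h ≤ θ) (hθ1 : θ < 1) (hB : p / (1 - θ) ≤ B) :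
    ∀ q ∈ Box c h, IsUnit (∑ x ∈ S, character x q • K x).det ∧ ‖(∑ x ∈ S, character x q • K x)⁻¹‖ ≤ B := by
  intro q hq
  have hh : ∀ μ, 0 ≤ h μ := fun μ => (abs_nonneg _).trans (hq μ).1
  have hp : 0 ≤ p := (coeffNormSum_nonneg T_P Z hh).trans hP
  refine box_certificate_taylor hm S K hsmall (P := fun q => polyEval T_P Z (boxDisp c q)) (fun q' hq' => ?_)
    (norm_polyEval_boxDisp_le T_P Z hP) hp hθ hθ1 hB q hq
  rw [one_sub_polyEval_mul_taylorFamily]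
  exact norm_polyEval_boxDisp_le _ _ hE q' hq'

end

end Summit.QuantumFields.BalabanUV.Beta.ResolventBoxCertificate

/-! ## §6 The admitted residual record (p230938) in coefficient currency -/

namespace Summit.QuantumFields.BalabanUV.Beta.ResolventResidualLeafRecord

open Complex Set Matrix Finset
open Summit.QuantumFields.BalabanUV.Beta.PolyRegularAlgebra (character)
open Summit.QuantumFields.BalabanUV.Beta.ResolventBoxCertificate
open scoped Real Matrix.Norms.L2Operator Pointwise

noncomputable section

variable {d : ℕ} {n : Type*} [Fintype n] [DecidableEq n] [DecidableEq (Fin (d + 1) → ℕ)]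

/-- **A VALID RESIDUAL RECORD CERTIFIES ITS BOX FROM COEFFICIENT DATA**: validity + the coefficient matrices `Z_β` of a polynomial preconditioner +
`Σ h^γ ‖residualCoeff γ‖ ≤ ε`, `Σ h^β ‖Z_β‖ ≤ p`, a tail bound `taylorTail ≤ T` and `ε + p·T ≤ θ` ⟹ the stencil family is invertible with
`‖(A q)⁻¹‖ ≤ B` on the record's box — the record's two «sups» DISCHARGED from finite coefficient-norm sums, no sup hypothesis. [folklore] -/
theorem ResidualLeafRecord.certifies_ofCoeffs (r : ResidualLeafRecord d) (hv : r.Valid) {m : ℕ} (hm : 0 < m)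
    (S : Finset (Fin (d + 1) → ℤ)) (K : (Fin (d + 1) → ℤ) → Matrix n n ℂ) (hsmall : ∀ x ∈ S, ∑ μ, |(x μ : ℝ)| * r.hw μ ≤ 1)
    (T_P : Finset (Fin (d + 1) → ℕ)) (Z : (Fin (d + 1) → ℕ) → Matrix n n ℂ) {ε T : ℝ}
    (hE : ∑ γ ∈ insert 0 (T_P + degLT d m), monomial γ r.hw * ‖residualCoeff T_P Z m S K r.ctr γ‖ ≤ ε)
    (hP : ∑ β ∈ T_P, monomial β r.hw * ‖Z β‖ ≤ r.p) (hT : taylorTail m S K r.ctr r.hw ≤ T) (hθ : ε + r.p * T ≤ r.θ) :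
    ∀ q ∈ r.box, IsUnit (∑ x ∈ S, character x q • K x).det ∧ ‖(∑ x ∈ S, character x q • K x)⁻¹‖ ≤ r.B := by
  obtain ⟨hp0, hθ1, hpB⟩ := hv
  have hθ1' : (r.θ : ℝ) < 1 := by exact_mod_cast hθ1
  have hp0' : (0 : ℝ) ≤ r.p := by exact_mod_cast hp0
  have hB : (r.p : ℝ) / (1 - r.θ) ≤ r.B := by
    rw [div_le_iff₀ (by linarith)]
    exact_mod_cast hpB
  have hθ' : ε + (r.p : ℝ) * taylorTail m S K r.ctr r.hw ≤ r.θ :=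
    (add_le_add le_rfl (mul_le_mul_of_nonneg_left hT hp0')).trans hθ
  exact box_certificate_taylor_ofCoeffs hm S K hsmall T_P Z hE hP hθ' hθ1' hB

/-- with a uniform budget. [folklore] -/
theorem ResidualLeafRecord.certifies_ofCoeffs_le (r : ResidualLeafRecord d) (hv : r.Valid) {Ba : ℝ} (hBa : (r.B : ℝ) ≤ Ba)
    {m : ℕ} (hm : 0 < m) (S : Finset (Fin (d + 1) → ℤ)) (K : (Fin (d + 1) → ℤ) → Matrix n n ℂ)
    (hsmall : ∀ x ∈ S, ∑ μ, |(x μ : ℝ)| * r.hw μ ≤ 1)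
    (T_P : Finset (Fin (d + 1) → ℕ)) (Z : (Fin (d + 1) → ℕ) → Matrix n n ℂ) {ε T : ℝ}
    (hE : ∑ γ ∈ insert 0 (T_P + degLT d m), monomial γ r.hw * ‖residualCoeff T_P Z m S K r.ctr γ‖ ≤ ε)
    (hP : ∑ β ∈ T_P, monomial β r.hw * ‖Z β‖ ≤ r.p) (hT : taylorTail m S K r.ctr r.hw ≤ T) (hθ : ε + r.p * T ≤ r.θ) :
    ∀ q ∈ r.box, IsUnit (∑ x ∈ S, character x q • K x).det ∧ ‖(∑ x ∈ S, character x q • K x)⁻¹‖ ≤ Ba := fun q hq =>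
  let h := r.certifies_ofCoeffs hv hm S K hsmall T_P Z hE hP hT hθ q hq
  ⟨h.1, h.2.trans hBa⟩

/-- **`hcert` FROM RESIDUAL RECORDS IN COEFFICIENT CURRENCY**: one record per box of a list (valid, budget `≤ Ba`, box inside the record's box) and
per record the engine's coefficient data `(m, T_P, Z, ε, T)` with the two finite coefficient-norm sums, the tail bound and `ε + p·T ≤ θ` ⟹ the
binder `hcert` of every route-A anchor for the stencil family — NO sup hypothesis, NO closed form. [folklore] -/
theorem hcert_of_residualRecords_ofCoeffs {boxes : Finset ((Fin (d + 1) → ℂ) × (Fin (d + 1) → ℝ))}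
    (rec : (Fin (d + 1) → ℂ) × (Fin (d + 1) → ℝ) → ResidualLeafRecord d) {Ba : ℝ}
    (hvalid : ∀ bx ∈ boxes, (rec bx).Valid ∧ ((rec bx).B : ℝ) ≤ Ba)
    (hsub : ∀ bx ∈ boxes, Box bx.1 bx.2 ⊆ (rec bx).box)
    (S : Finset (Fin (d + 1) → ℤ)) (K : (Fin (d + 1) → ℤ) → Matrix n n ℂ)
    (hsmall : ∀ bx ∈ boxes, ∀ x ∈ S, ∑ μ, |(x μ : ℝ)| * (rec bx).hw μ ≤ 1)
    (m : (Fin (d + 1) → ℂ) × (Fin (d + 1) → ℝ) → ℕ) (hm : ∀ bx ∈ boxes, 0 < m bx)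
    (T_P : (Fin (d + 1) → ℂ) × (Fin (d + 1) → ℝ) → Finset (Fin (d + 1) → ℕ))
    (Z : (Fin (d + 1) → ℂ) × (Fin (d + 1) → ℝ) → (Fin (d + 1) → ℕ) → Matrix n n ℂ)
    (ε T : (Fin (d + 1) → ℂ) × (Fin (d + 1) → ℝ) → ℝ)
    (hE : ∀ bx ∈ boxes, ∑ γ ∈ insert 0 (T_P bx + degLT d (m bx)), monomial γ (rec bx).hw *
      ‖residualCoeff (T_P bx) (Z bx) (m bx) S K (rec bx).ctr γ‖ ≤ ε bx)
    (hP : ∀ bx ∈ boxes, ∑ β ∈ T_P bx, monomial β (rec bx).hw * ‖Z bx β‖ ≤ (rec bx).p)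
    (hT : ∀ bx ∈ boxes, taylorTail (m bx) S K (rec bx).ctr (rec bx).hw ≤ T bx)
    (hθ : ∀ bx ∈ boxes, ε bx + (rec bx).p * T bx ≤ (rec bx).θ) :
    ∀ bx ∈ boxes, ∀ q ∈ Box bx.1 bx.2,
      IsUnit (∑ x ∈ S, character x q • K x).det ∧ ‖(∑ x ∈ S, character x q • K x)⁻¹‖ ≤ Ba := fun bx hbx q hq =>
  (rec bx).certifies_ofCoeffs_le (hvalid bx hbx).1 (hvalid bx hbx).2 (hm bx hbx) S K (hsmall bx hbx) (T_P bx) (Z bx) (hE bx hbx)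
    (hP bx hbx) (hT bx hbx) (hθ bx hbx) q (hsub bx hbx hq)

end

end Summit.QuantumFields.BalabanUV.Beta.ResolventResidualLeafRecord
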